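import Summits.BirchSwinnertonDyer.Rank1Residual.Supersingular.LocalOddTorsionDeciderAt
import Summits.BirchSwinnertonDyer.Rank1Residual.GaloisImage.LocalThreeTorsionAdicCompletionAt
import HarnessLib

/-!
# The local torsion counts `#ker([5] : F(ℚ_w))`, `#ker([7] : F(ℚ_w))` at a place `w` of ANY prime `ℓ`,
# VISIBILITY currency: the binders of the rank-0 visibility offers as KERNEL numbers from the decider
# `fiveTorsionCheckAt` / `sevenTorsionCheckAt` (cell `b2b-bsdres`, supersingular family, prover A = unit
# `b2b-bsdres-x10b`, gen 23; the odd-prime twin of n1011's `LocalThreeTorsionAdicCompletionAt`)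

HONEST FRAMING (cell `b2b-bsdres`, run/shared/lean/b2b/bsd-rank1-residual/, verbatim in every
file): the goal of the cell is to DELETE the COMBINATION-SHAPED residual classes of the
Birch–Swinnerton-Dyer formula for ALL analytic-rank `≤ 1` elliptic curves over `ℚ` — "full BSD
formula for every rank `≤ 1` curve in class `C`" assembled STRICTLY from published theorems — so
that the rank-`≤ 1` remainder becomes exactly the CONSTRUCTION-SHAPED classes, which are TYPED
(missing-input `Prop`s), NOT attempted. This is not "finishing BSD". THIS FILE IS A TOOL: theorems
only (no definition, no named fact, no `sorry`); it closes nothing, books nothing, moves no mark /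
label / count; X6 / X7 stay CONSTRUCTION-SHAPED.

## What

The rank-0 VISIBILITY offers `bsdp_x6r0vis…` / `bsdp_x7r0vis…` (`Supersingular/X6Visibility*`,
`X7Visibility*`, x10b gen 15–16; Cremona–Mazur / Fisher `p`-congruent partner `F` of positive rank)
display, per place `w ∈ S \ T` of free kind (i) and at the paid place `w = p`, the binder
`∀ w, (primesEquiv w : ℕ) = ℓ → Nat.card (nsmulAddMonoidHom p : (F.baseChange (w.adicCompletion ℚ)).toAffine.Point →+ _).ker = 1`
(`p = 5, 7`; 164 binder slots, 71 distinct (F, ℓ, p) triples; so far two-engine EVIDENCE, gen 15/16),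
and per place of free kind (ii) the numeral `… ≤ p` for the target. This file reads them off the
kernel decider `LocalOddTorsion.fiveTorsionCheckAt` / `sevenTorsionCheckAt`
(`Supersingular/LocalOddTorsionDeciderAt.lean`) through p18's currency bridge
`LocalTorsion3.natCard_ker_nsmul_adicCompletion_eq_natCard_torsion_padic` (generic `p`, `n`):

* `natCard_ker_nsmul_adicCompletion_eq_of_torsionCheckAt` — `#ker([n] : E(ℚ_v)) = 1 + 2S` (odd prime
  `n`, any prime `p`, `W = ⟨a₁, …, a₆⟩`, `ofList l = preΨ'ₙ`, `torsionCheckAt p … = some S`);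
* **`natCard_ker_nsmul_five_adicCompletion_eq_one_of_checkAt`** /
  **`natCard_ker_nsmul_seven_adicCompletion_eq_one_of_checkAt`** — `S = 0` gives the binder LITERALLY;
* `…_eq_of_checkAt` (`1 + 2S`) and `…_le_five_of_checkAt` / `…_le_seven_of_checkAt` (the numeral
  `≤ p` of free kind (ii), `S ≤ 2` / `S ≤ 3`).

Certificates per (curve, place): x10b gen 23 `certs/kind1_certs.json` (found by `code/oddtors_cert.py`,
checked in the kernel by `decide +kernel` only when a record invokes these theorems). NOT claimed:
any congruence, rank certificate, reduction-type predicate or record.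
References: [SilvermanAEC2009] VII.3, Ex. 3.7, IV.6.1; [Serre1973] Ch. II §3.3; [CremonaMazur2000] §3.
-/

set_option autoImplicit false

noncomputable section

open scoped Classical NumberField
open IsDedekindDomain NumberField WeierstrassCurve Rat.HeightOneSpectrum
open Summit.BirchSwinnertonDyer.Rank1Residual.GaloisImage.RootCensus (ofList)
open Summit.BirchSwinnertonDyer.Rank1Residual.GaloisImage.LocalTorsion3
  (natCard_ker_nsmul_adicCompletion_eq_natCard_torsion_padic)

namespace Summit.BirchSwinnertonDyer.Rank1Residual.Supersingular.LocalOddTorsion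

section Bridge

variable (p : ℕ) [hp : Fact p.Prime] (a₁ a₂ a₃ a₄ a₆ : ℤ)

/-- **`#ker([n] : E(ℚ_v)) = 1 + 2S` at the place `v` of `p` from the decider** (odd prime `n`, any
prime `p`, `W = ⟨a₁, …, a₆⟩` with `Δ ≠ 0`, `ofList l = preΨ'ₙ`, `torsionCheckAt p … l k cert = some S`).
[cite: SilvermanAEC2009, VII.3.1 and Ex. 3.7] -/
theorem natCard_ker_nsmul_adicCompletion_eq_of_torsionCheckAt {n : ℕ} (hn : n.Prime) (hn2 : n ≠ 2)
    (hΔ : (⟨a₁, a₂, a₃, a₄, a₆⟩ : WeierstrassCurve ℤ).Δ ≠ 0) {l : List ℤ}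
    (hl : ofList l = (⟨a₁, a₂, a₃, a₄, a₆⟩ : WeierstrassCurve ℤ).preΨ' n) {k S : ℕ}
    {cert : List (ℤ × ℕ × ℕ × ℕ)} (h : torsionCheckAt p ⟨a₁, a₂, a₃, a₄, a₆⟩ l k cert = some S)
    (W : WeierstrassCurve ℚ) (hW : W = ⟨a₁, a₂, a₃, a₄, a₆⟩)
    {v : HeightOneSpectrum (𝓞 ℚ)} (hv : (primesEquiv v : ℕ) = p) :
    Nat.card (nsmulAddMonoidHom n : (W.baseChange (v.adicCompletion ℚ)).toAffine.Point →+
      (W.baseChange (v.adicCompletion ℚ)).toAffine.Point).ker = 1 + 2 * S := by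
  subst hW
  rw [natCard_ker_nsmul_adicCompletion_eq_natCard_torsion_padic _ v hv n]
  exact natCard_torsion_padic_eq_of_check p a₁ a₂ a₃ a₄ a₆ hn hn2 hΔ hl h

/-- **The visibility binder at `5`, LITERALLY, from the decider** (`S = 0`):
`Nat.card (nsmulAddMonoidHom 5 : (W.baseChange (v.adicCompletion ℚ)).toAffine.Point →+ _).ker = 1`
for `W = ⟨a₁, …, a₆⟩` at the place `v` of a prime `p` with `fiveTorsionCheckAt p a₁ … a₆ k cert =
some 0` (free kind (i) at `p ≠ 5`; the paid place at `p = 5`). [cite: SilvermanAEC2009, VII.3.1 and Ex. 3.7]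
[cite: CremonaMazur2000, §3] -/
theorem natCard_ker_nsmul_five_adicCompletion_eq_one_of_checkAt
    (hΔ : (⟨a₁, a₂, a₃, a₄, a₆⟩ : WeierstrassCurve ℤ).Δ ≠ 0) {k : ℕ}
    {cert : List (ℤ × ℕ × ℕ × ℕ)} (h : fiveTorsionCheckAt p a₁ a₂ a₃ a₄ a₆ k cert = some 0)
    (W : WeierstrassCurve ℚ) (hW : W = ⟨a₁, a₂, a₃, a₄, a₆⟩)
    {v : HeightOneSpectrum (𝓞 ℚ)} (hv : (primesEquiv v : ℕ) = p) :
    Nat.card (nsmulAddMonoidHom 5 : (W.baseChange (v.adicCompletion ℚ)).toAffine.Point →+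
      (W.baseChange (v.adicCompletion ℚ)).toAffine.Point).ker = 1 := by
  rw [natCard_ker_nsmul_adicCompletion_eq_of_torsionCheckAt p a₁ a₂ a₃ a₄ a₆ (n := 5) (by norm_num)
    (by norm_num) hΔ ofList_prePsi5Z h W hW hv]

/-- **The visibility binder at `7`, LITERALLY, from the decider** (`S = 0`):
`Nat.card (nsmulAddMonoidHom 7 : (W.baseChange (v.adicCompletion ℚ)).toAffine.Point →+ _).ker = 1`
for `W = ⟨a₁, …, a₆⟩` at the place `v` of a prime `p` with `sevenTorsionCheckAt p a₁ … a₆ k cert =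
some 0`. [cite: SilvermanAEC2009, VII.3.1 and Ex. 3.7] [cite: CremonaMazur2000, §3] -/
theorem natCard_ker_nsmul_seven_adicCompletion_eq_one_of_checkAt
    (hΔ : (⟨a₁, a₂, a₃, a₄, a₆⟩ : WeierstrassCurve ℤ).Δ ≠ 0) {k : ℕ}
    {cert : List (ℤ × ℕ × ℕ × ℕ)} (h : sevenTorsionCheckAt p a₁ a₂ a₃ a₄ a₆ k cert = some 0)
    (W : WeierstrassCurve ℚ) (hW : W = ⟨a₁, a₂, a₃, a₄, a₆⟩)
    {v : HeightOneSpectrum (𝓞 ℚ)} (hv : (primesEquiv v : ℕ) = p) :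
    Nat.card (nsmulAddMonoidHom 7 : (W.baseChange (v.adicCompletion ℚ)).toAffine.Point →+
      (W.baseChange (v.adicCompletion ℚ)).toAffine.Point).ker = 1 := by
  rw [natCard_ker_nsmul_adicCompletion_eq_of_torsionCheckAt p a₁ a₂ a₃ a₄ a₆ (n := 7) (by norm_num)
    (by norm_num) hΔ ofList_prePsi7Z h W hW hv]

/-- General count in the visibility currency at `5`: `#ker([5] : E(ℚ_v)) = 1 + 2S`. [folklore] -/
theorem natCard_ker_nsmul_five_adicCompletion_eq_of_checkAt
    (hΔ : (⟨a₁, a₂, a₃, a₄, a₆⟩ : WeierstrassCurve ℤ).Δ ≠ 0) {k S : ℕ}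
    {cert : List (ℤ × ℕ × ℕ × ℕ)} (h : fiveTorsionCheckAt p a₁ a₂ a₃ a₄ a₆ k cert = some S)
    (W : WeierstrassCurve ℚ) (hW : W = ⟨a₁, a₂, a₃, a₄, a₆⟩)
    {v : HeightOneSpectrum (𝓞 ℚ)} (hv : (primesEquiv v : ℕ) = p) :
    Nat.card (nsmulAddMonoidHom 5 : (W.baseChange (v.adicCompletion ℚ)).toAffine.Point →+
      (W.baseChange (v.adicCompletion ℚ)).toAffine.Point).ker = 1 + 2 * S :=
  natCard_ker_nsmul_adicCompletion_eq_of_torsionCheckAt p a₁ a₂ a₃ a₄ a₆ (n := 5) (by norm_num)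
    (by norm_num) hΔ ofList_prePsi5Z h W hW hv

/-- General count in the visibility currency at `7`: `#ker([7] : E(ℚ_v)) = 1 + 2S`. [folklore] -/
theorem natCard_ker_nsmul_seven_adicCompletion_eq_of_checkAt
    (hΔ : (⟨a₁, a₂, a₃, a₄, a₆⟩ : WeierstrassCurve ℤ).Δ ≠ 0) {k S : ℕ}
    {cert : List (ℤ × ℕ × ℕ × ℕ)} (h : sevenTorsionCheckAt p a₁ a₂ a₃ a₄ a₆ k cert = some S)
    (W : WeierstrassCurve ℚ) (hW : W = ⟨a₁, a₂, a₃, a₄, a₆⟩)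
    {v : HeightOneSpectrum (𝓞 ℚ)} (hv : (primesEquiv v : ℕ) = p) :
    Nat.card (nsmulAddMonoidHom 7 : (W.baseChange (v.adicCompletion ℚ)).toAffine.Point →+
      (W.baseChange (v.adicCompletion ℚ)).toAffine.Point).ker = 1 + 2 * S :=
  natCard_ker_nsmul_adicCompletion_eq_of_torsionCheckAt p a₁ a₂ a₃ a₄ a₆ (n := 7) (by norm_num)
    (by norm_num) hΔ ofList_prePsi7Z h W hW hv

/-- **The numeral of free kind (ii) at `5`, from the decider**: `#ker([5] : E(ℚ_v)) ≤ 5` for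
`W = ⟨a₁, …, a₆⟩` at the place `v` of `p` when `fiveTorsionCheckAt p a₁ … a₆ k cert = some S` with
`S ≤ 2` (split multiplicative `v ≡ 1 (mod 5)`: the count is `5` exactly, `S = 2`).
[cite: SilvermanAEC2009, VII.3.1 and Ex. 3.7] [cite: CremonaMazur2000, §3] -/
theorem natCard_ker_nsmul_five_adicCompletion_le_five_of_checkAt
    (hΔ : (⟨a₁, a₂, a₃, a₄, a₆⟩ : WeierstrassCurve ℤ).Δ ≠ 0) {k S : ℕ}
    {cert : List (ℤ × ℕ × ℕ × ℕ)} (h : fiveTorsionCheckAt p a₁ a₂ a₃ a₄ a₆ k cert = some S)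
    (hS : S ≤ 2) (W : WeierstrassCurve ℚ) (hW : W = ⟨a₁, a₂, a₃, a₄, a₆⟩)
    {v : HeightOneSpectrum (𝓞 ℚ)} (hv : (primesEquiv v : ℕ) = p) :
    Nat.card (nsmulAddMonoidHom 5 : (W.baseChange (v.adicCompletion ℚ)).toAffine.Point →+
      (W.baseChange (v.adicCompletion ℚ)).toAffine.Point).ker ≤ 5 := by
  rw [natCard_ker_nsmul_five_adicCompletion_eq_of_checkAt p a₁ a₂ a₃ a₄ a₆ hΔ h W hW hv]
  omega

/-- **The numeral of free kind (ii) at `7`, from the decider**: `#ker([7] : E(ℚ_v)) ≤ 7` when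
`sevenTorsionCheckAt p a₁ … a₆ k cert = some S` with `S ≤ 3`. [cite: SilvermanAEC2009, VII.3.1 and Ex. 3.7]
[cite: CremonaMazur2000, §3] -/
theorem natCard_ker_nsmul_seven_adicCompletion_le_seven_of_checkAt
    (hΔ : (⟨a₁, a₂, a₃, a₄, a₆⟩ : WeierstrassCurve ℤ).Δ ≠ 0) {k S : ℕ}
    {cert : List (ℤ × ℕ × ℕ × ℕ)} (h : sevenTorsionCheckAt p a₁ a₂ a₃ a₄ a₆ k cert = some S)
    (hS : S ≤ 3) (W : WeierstrassCurve ℚ) (hW : W = ⟨a₁, a₂, a₃, a₄, a₆⟩)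
    {v : HeightOneSpectrum (𝓞 ℚ)} (hv : (primesEquiv v : ℕ) = p) :
    Nat.card (nsmulAddMonoidHom 7 : (W.baseChange (v.adicCompletion ℚ)).toAffine.Point →+
      (W.baseChange (v.adicCompletion ℚ)).toAffine.Point).ker ≤ 7 := by
  rw [natCard_ker_nsmul_seven_adicCompletion_eq_of_checkAt p a₁ a₂ a₃ a₄ a₆ hΔ h W hW hv]
  omega

end Bridge

end Summit.BirchSwinnertonDyer.Rank1Residual.Supersingular.LocalOddTorsion

end
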